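import Summits.Ventures.HSemireg.WedgeHankelRecurrenceGaussKernelRecurrence

/-!
# Venture HSemireg — **THE LAGUERRE CALIBRATION**: the monic Laguerre recurrence `a_n = 2n + 1 + α`, `b_{n+1} = (n + 1)(n + 1 + α)` has Stieltjes ∕ birth–death parameters `λ_n = n + 1 + α`,
# `μ_n = n` (N373), hence `(−1)^n L_n^{(α)}(0) = (α + 1)(α + 2)⋯(α + n)`; for `α > −1` ALL ZEROS ARE POSITIVE, they sum to `(t + 1)(t + 1 + α)` and lie below `2t + 1 + α + 2√(t(t + α))` (Wall's
# bound, N372); and HERMITE ↔ LAGUERRE `∓½` by symmetrization (N374): `He_{2n}(x) = 2^n L_n^{(−1∕2)}(x²∕2)`, `He_{2n+1}(x) = x · 2^n L_n^{(1∕2)}(x²∕2)` (monic normalisations)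

HONEST FRAMING. Part of the Lean index of the computation cell `pub-hsemireg` (seat p10 gen 46, Sunday typer «UNIFORM-IN-n»).  Real polynomials, finite sums and `Real.sqrt` only; no variety, no
cohomology theory, no sheaf, no Ext group and no semiregularity map is constructed here; nothing here says that HC / HC_CM / HC_AV holds; no Literature fact (unproved `Prop`) is declared or used.
Custodian versions as in `WedgeHankelSiegelIdeal` (1/3).
SOURCES (cited).  G. Szegő, *Orthogonal Polynomials*, §5.1 (5.1.10) (the Laguerre recurrence), (5.1.7) (`L_n^{(α)}(0) = binom(n+α, n)`), §5.6 (5.6.1) (Hermite in terms of Laguerre `±½`), Thm 6.31.2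
(bounds for the largest zero); T. S. Chihara, *An Introduction to Orthogonal Polynomials* (1978), Ch. V §3 (Laguerre), Ch. I §9 (the S-fraction `(α+1, 1, α+2, 2, …)`); M. Abramowitz,
I. Stegun, *Handbook*, 22.7.12, 22.5.40–41; W. Gautschi, *Orthogonal Polynomials: Computation and Approximation* (2004), Table 1.1.
PROOF TYPED HERE.  The data identities `2n + 1 + α = (n + 1 + α) + n`, `(n+1)(n+1+α) = (n + 1 + α)(n + 1)` feed N373 (`recurrence_alt_eval_zero_of_birthDeath`, `zeros_pos_of_birthDeath`); the sum of
the zeros is N298 `sum_recurrence_zeros`; the upper bound is N372 `zeros_lt_of_wall_quarter` with `c = √(t(t+α))`; the Hermite identities are N374 `symmetrization_even_odd` for `c_n = n` with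
the two contracted recurrences identified as rescaled Laguerre `∓½` recurrences through N324 `recurrence_scale_spec` (`c = 2`).
DEDUP DISCLOSURE (`rg -n -i 'laguerre' Summits/Ventures/HSemireg`, 2026-09-03): `Literature.Algebra.Polynomial.LaguerreRootBound` is LAGUERRE–SAMUELSON's root bound (N298 ∕ N310 use it), not the
Laguerre polynomials; N334 `laguerre_inequality_recurrence` is Laguerre's `P P″ < P′²`; no Laguerre recurrence ∕ zeros ∕ Hermite link.  The 5 names below: 0 hits tree-wide.

WHAT IS IN THE TREE.  N373, N372, N374 as above; N298 `sum_recurrence_zeros`; N279 `recurrence_zeros_interlace`; N324 `recurrence_scale_spec`; N359 `hermite_real_recurrence`.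
THIS FILE (namespace `Summit.Ventures.HSemireg.Wedge.HankelOuter` continued; CHAINED on N375 (import only); 0 definitions):
* §1141 **`laguerre_alt_eval_zero`** (`(−1)^n L_n(0) = ∏_{k<n} (k + 1 + α)`), **`laguerre_zeros_pos`** (`α > −1` ⇒ zeros `> 0`), **`laguerre_zeros`** (increasing positive zeros, product form, sum
  `(t+1)(t+1+α)`), `laguerre_zeros_lt` (`< 2t + 1 + α + 2√(t(t+α))`, `t ≥ 1`), **`hermite_even_odd_laguerre`** (`He_{2n} = (2^n L^{(−½)}_n(X∕2))(X²)`, `He_{2n+1} = X · (2^n L^{(½)}_n(X∕2))(X²)`).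
CAVEATS.  The Laguerre family enters only through its recurrence (no Rodrigues formula, weight or orthogonality integral is typed); normalisation monic.  Nothing Ext-side.  New names only.
-/

open Module Polynomial
open scoped Matrix Polynomial

namespace Summit.Ventures.HSemireg.Wedge.HankelOuter

/-! ## §1141. The Laguerre recurrence -/

/-- **`(−1)^n L_n^{(α)}(0) = (α + 1)(α + 2)⋯(α + n)`** for the monic Laguerre recurrence `a_n = 2n + 1 + α`, `b_{n+1} = (n+1)(n+1+α)`. [Szegő (5.1.7); this file, §1141] -/
theorem laguerre_alt_eval_zero {L : ℕ → ℝ[X]} {a b : ℕ → ℝ} {α : ℝ} (hL0 : L 0 = 1) (hL1 : L 1 = Polynomial.X - C (a 0))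
    (hLrec : ∀ n, L (n + 2) = (Polynomial.X - C (a (n + 1))) * L (n + 1) - C (b (n + 1)) * L n) (ha : ∀ n, a n = 2 * n + 1 + α)
    (hb : ∀ n, b (n + 1) = ((n : ℝ) + 1) * ((n : ℝ) + 1 + α)) (n : ℕ) : (-1 : ℝ) ^ n * (L n).eval 0 = ∏ k ∈ Finset.range n, ((k : ℝ) + 1 + α) :=
  recurrence_alt_eval_zero_of_birthDeath hL0 hL1 hLrec (t := n) (l := fun k => (k : ℝ) + 1 + α) (m := fun k => (k : ℝ)) (by simp)
    (fun k _ => by rw [ha]; ring) (fun k _ => by rw [hb]; push_cast; ring) n (by omega)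

/-- **For `α > −1` every zero of `L_{t+1}^{(α)}` is positive** (Stieltjes: positive birth–death parameters `λ_n = n + 1 + α`, `μ_n = n`). [Szegő §5.1; Chihara I Thm 9.1; this file, §1141] -/
theorem laguerre_zeros_pos {L : ℕ → ℝ[X]} {a b : ℕ → ℝ} {α : ℝ} (hL0 : L 0 = 1) (hL1 : L 1 = Polynomial.X - C (a 0))
    (hLrec : ∀ n, L (n + 2) = (Polynomial.X - C (a (n + 1))) * L (n + 1) - C (b (n + 1)) * L n) (ha : ∀ n, a n = 2 * n + 1 + α)
    (hb : ∀ n, b (n + 1) = ((n : ℝ) + 1) * ((n : ℝ) + 1 + α)) (hα : -1 < α) (hb0 : 0 < b 0) (t : ℕ) : ∀ s, (L (t + 1)).eval s = 0 → 0 < s := by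
  have hbpos : ∀ j, 0 < b j := fun j => by
    rcases j with _ | k
    · exact hb0
    · rw [hb]; exact mul_pos (by positivity) (by have : (0 : ℝ) ≤ k := Nat.cast_nonneg k; linarith)
  exact zeros_pos_of_birthDeath hL0 hL1 hLrec hbpos (l := fun k => (k : ℝ) + 1 + α) (m := fun k => (k : ℝ)) (by simp)
    (fun k _ => by have : (0 : ℝ) ≤ k := Nat.cast_nonneg k; show (0 : ℝ) < k + 1 + α; linarith) (fun k _ => by rw [ha]; ring) (fun k _ => by rw [hb]; push_cast; ring)

/-- **THE ZEROS OF `L_{t+1}^{(α)}` (`α > −1`): `t + 1` simple positive zeros `0 < x_0 < ⋯ < x_t` with `L_{t+1} = ∏ (X − x_k)` and `Σ x_k = (t + 1)(t + 1 + α)`.** [Szegő §5.1, (5.1.10); Chihara V §3; this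
file, §1141] -/
theorem laguerre_zeros {L : ℕ → ℝ[X]} {a b : ℕ → ℝ} {α : ℝ} (hL0 : L 0 = 1) (hL1 : L 1 = Polynomial.X - C (a 0))
    (hLrec : ∀ n, L (n + 2) = (Polynomial.X - C (a (n + 1))) * L (n + 1) - C (b (n + 1)) * L n) (ha : ∀ n, a n = 2 * n + 1 + α)
    (hb : ∀ n, b (n + 1) = ((n : ℝ) + 1) * ((n : ℝ) + 1 + α)) (hα : -1 < α) (hb0 : 0 < b 0) (t : ℕ) :
    ∃ x : Fin (t + 1) → ℝ, StrictMono x ∧ L (t + 1) = ∏ k, (Polynomial.X - C (x k)) ∧ (∀ k, 0 < x k) ∧ ∑ k, x k = ((t : ℝ) + 1) * ((t : ℝ) + 1 + α) := by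
  have hbpos : ∀ j, 0 < b j := fun j => by
    rcases j with _ | k
    · exact hb0
    · rw [hb]; exact mul_pos (by positivity) (by have : (0 : ℝ) ≤ k := Nat.cast_nonneg k; linarith)
  obtain ⟨x, -, hx, -, hxq, -, -⟩ := recurrence_zeros_interlace hL0 hL1 hLrec hbpos t
  have hpos := laguerre_zeros_pos hL0 hL1 hLrec ha hb hα hb0 t
  have hsum : ∀ m : ℕ, ∑ i ∈ Finset.range (m + 1), (2 * (i : ℝ) + 1 + α) = ((m : ℝ) + 1) * ((m : ℝ) + 1 + α) := by
    intro m
    induction m with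
    | zero => simp
    | succ m ih => rw [Finset.sum_range_succ, ih]; push_cast; ring
  refine ⟨x, hx, hxq, fun k => hpos _ (by rw [hxq, eval_prod]; exact Finset.prod_eq_zero (Finset.mem_univ k) (by simp)), ?_⟩
  rw [sum_recurrence_zeros hL0 hL1 hLrec hxq, Finset.sum_congr rfl fun i _ => ha i, hsum]

/-- **Upper bound (Wall's `1∕4`): for `α > −1` and `t ≥ 1` every zero of `L_{t+1}^{(α)}` is `< 2t + 1 + α + 2 √(t(t + α))`** (`a_n ≤ 2t + 1 + α`, `b_n ≤ t(t+α)` for `n ≤ t`). [N372; Szegő Thm 6.31.2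
(cf.); this file, §1141] -/
theorem laguerre_zeros_lt {L : ℕ → ℝ[X]} {a b : ℕ → ℝ} {α : ℝ} (hL0 : L 0 = 1) (hL1 : L 1 = Polynomial.X - C (a 0))
    (hLrec : ∀ n, L (n + 2) = (Polynomial.X - C (a (n + 1))) * L (n + 1) - C (b (n + 1)) * L n) (ha : ∀ n, a n = 2 * n + 1 + α)
    (hb : ∀ n, b (n + 1) = ((n : ℝ) + 1) * ((n : ℝ) + 1 + α)) (hα : -1 < α) (hb0 : 0 < b 0) {t : ℕ} (ht : 1 ≤ t) :
    ∀ s, (L (t + 1)).eval s = 0 → s < 2 * t + 1 + α + 2 * Real.sqrt (t * (t + α)) := by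
  have hbpos : ∀ j, 0 < b j := fun j => by
    rcases j with _ | k
    · exact hb0
    · rw [hb]; exact mul_pos (by positivity) (by have : (0 : ℝ) ≤ k := Nat.cast_nonneg k; linarith)
  have ht' : (1 : ℝ) ≤ t := by exact_mod_cast ht
  have htα : 0 < (t : ℝ) * (t + α) := mul_pos (by linarith) (by linarith)
  refine zeros_lt_of_wall_quarter hL0 hL1 hLrec hbpos (c := Real.sqrt (t * (t + α))) (Real.sqrt_pos.2 htα) (fun n hn => ?_) fun n hn => ?_
  · rw [ha]; have : (n : ℝ) ≤ t := by exact_mod_cast hn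
    linarith
  · rw [hb, Real.sq_sqrt htα.le]
    have h1 : (n : ℝ) + 1 ≤ t := by exact_mod_cast hn
    have h0 : (0 : ℝ) ≤ n := Nat.cast_nonneg n
    nlinarith

/-- **HERMITE ↔ LAGUERRE `∓½` (symmetrization): `He_{2n} = (2^n L^{(−½)}_n(X∕2))(X²)` and `He_{2n+1} = X · (2^n L^{(½)}_n(X∕2))(X²)`** for Mathlib's probabilists' Hermite polynomials and the monic
Laguerre recurrences with `α = −½` (`a_n = 2n + ½`, `b_{n+1} = (n+1)(n+½)`) and `α = ½` (`a_n = 2n + 3∕2`, `b_{n+1} = (n+1)(n+3∕2)`). [Szegő (5.6.1); Chihara I Thm 8.1; this file, §1141] -/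
theorem hermite_even_odd_laguerre {L L' : ℕ → ℝ[X]} {a b a' b' : ℕ → ℝ} (hL0 : L 0 = 1) (hL1 : L 1 = Polynomial.X - C (a 0))
    (hLrec : ∀ n, L (n + 2) = (Polynomial.X - C (a (n + 1))) * L (n + 1) - C (b (n + 1)) * L n) (ha : ∀ n, a n = 2 * n + 1 / 2)
    (hb : ∀ n, b (n + 1) = ((n : ℝ) + 1) * ((n : ℝ) + 1 / 2))
    (hL0' : L' 0 = 1) (hL1' : L' 1 = Polynomial.X - C (a' 0)) (hLrec' : ∀ n, L' (n + 2) = (Polynomial.X - C (a' (n + 1))) * L' (n + 1) - C (b' (n + 1)) * L' n)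
    (ha' : ∀ n, a' n = 2 * n + 3 / 2) (hb' : ∀ n, b' (n + 1) = ((n : ℝ) + 1) * ((n : ℝ) + 3 / 2)) (n : ℕ) :
    (Polynomial.hermite (2 * n)).map (Int.castRingHom ℝ) = (C ((2 : ℝ) ^ n) * (L n).comp (C (2 : ℝ)⁻¹ * Polynomial.X)).comp (Polynomial.X ^ 2) ∧
      (Polynomial.hermite (2 * n + 1)).map (Int.castRingHom ℝ) = Polynomial.X * (C ((2 : ℝ) ^ n) * (L' n).comp (C (2 : ℝ)⁻¹ * Polynomial.X)).comp (Polynomial.X ^ 2) := by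
  obtain ⟨h0, h1, hr⟩ := hermite_real_recurrence
  obtain ⟨q0, q1, qrec, -⟩ := recurrence_scale_spec hL0 hL1 hLrec (c := 2) two_ne_zero
  obtain ⟨k0, k1, krec, -⟩ := recurrence_scale_spec hL0' hL1' hLrec' (c := 2) two_ne_zero
  exact symmetrization_even_odd (S := fun m => (Polynomial.hermite m).map (Int.castRingHom ℝ)) (aS := fun _ => (0 : ℝ)) (bS := fun m => (m : ℝ)) (c := fun m => (m : ℝ))
    (q := fun m => C ((2 : ℝ) ^ m) * (L m).comp (C (2 : ℝ)⁻¹ * Polynomial.X)) (k := fun m => C ((2 : ℝ) ^ m) * (L' m).comp (C (2 : ℝ)⁻¹ * Polynomial.X))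
    (a := fun m => 2 * a m) (b := fun m => 2 ^ 2 * b m) (a' := fun m => 2 * a' m) (b' := fun m => 2 ^ 2 * b' m)
    h0 h1 (fun m => by rw [hr m]; push_cast; rfl) (fun _ => rfl) (fun m => by push_cast; rfl) q0 q1 qrec k0 k1 krec
    (by rw [ha]; push_cast; ring) (fun m => by rw [ha]; push_cast; ring) (fun m => by rw [hb]; push_cast; ring)
    (fun m => by rw [ha']; push_cast; ring) (fun m => by rw [hb']; push_cast; ring) n

end Summit.Ventures.HSemireg.Wedge.HankelOuter
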